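import Summits.BirchSwinnertonDyer.Rank1Residual.X12.CMRamifiedRecordSchemaIMeaningLocal
import Literature.NumberTheory.EllipticCurves.HuShuYin2019.SylvesterThreePart
import Literature.NumberTheory.EllipticCurves.RootNumberTableThreeKodairaProofs
import Literature.NumberTheory.EllipticCurves.RootNumberTableThreeKodairaRowsProofs
import Literature.NumberTheory.EllipticCurves.QuadraticTwistTateFormTwoProofs
import Summits.BirchSwinnertonDyer.Rank1Residual.X12.CubeSumFamilies
import HarnessLib

/-!
# The cube-sum curves `E_n : x³ + y³ = n` (`y² = x³ − 432n²`): the Kodaira type at `3` of EVERY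
# model, for every cube-free `n`, by Tate's algorithm run in the kernel (Rizzo's Table II)

Cell `bsd-print-cf2` (run/shared/lean/pub/bsd-print-cf2/), seat ty2 (discharge interface), line
`route-BirchSwinnertonDyer-CMKolyvaginAtInertTwo` (leaf `Summit.BirchSwinnertonDyer.WAllCornerFTwo`;
items stmt-BirchSwinnertonDyer-22835/22836, residual 22838). HONEST FRAMING: THEOREMS ONLY — no
definition, no named fact, no route file imported, nothing about BSD asserted or booked; the leaf is
OPEN. Purpose: the habitat `H₂` of the line carries the binder `Odd W.tamagawaProduct`; for the cube-sum
family the Tamagawa numbers are read off the Kodaira symbols (`NeronComponentIndex*Proofs`: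
`c = 1` for II/II*, `c = 2` for III*, `c ∈ {1, 3}` for IV/IV*), and this file computes the symbol at
the one delicate place, `3`, for the whole family (companion `CubeSumLocalTypes.lean`: the places over
`2` and over `p ≥ 5`; `CMKolyvaginHabitatTamagawaCubeSums.lean`: the parity of `∏ c_ℓ`).

## What is here (`n ∈ ℤ ∖ {0}`; `B` any model, `∃ C, C • B = cubeSumCurve n`; `v ∣ 3`)

* §0 `cubeSumCurve n = (y² = x³ + k)`, `k = −432n² ∈ ℤ`, `v_p(k) = 2v_p(n)` at `p ≥ 5`, cube-free
  `n` has `v_p(n) ≤ 2`.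
* §2 the invariants `c₄ = 0`, `c₆ = 2⁹3⁶n²`, `Δ = −2¹²3⁹n⁴`; for `n = 3ᵉm`, `3 ∤ m`:
  `(v₃ c₄, v₃ c₆, v₃ Δ) = (∞, 6 + 2e, 9 + 4e)`, `c₆' ≡ 512m² ≡ 8, 5, 2 (mod 9)` as `m ≡ ±1, ±2, ±4`;
  Table II (which the tree PROVES equal to Tate's algorithm at `3`,
  `WeierstrassCurve.kodairaSymbolAt_eq_tableKodairaSymbolThree_of_primesEquiv_eq`) then reads:
  `e = 0`: row `(≥4,6,9)`/`(≥5,6,9)` — **`III*` iff `n ≡ ±2 (mod 9)`** (special condition `c₆'² + 2 ≡ 0`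
  holds iff `c₆' ≡ 5`), else **`IV*`**; `e = 1`: shift one, row ★`(≥2,2,1)`: **`II*`**; `e = 2`: shift
  one, row `(≥3,4,5)`: **`II`** — `kodairaSymbolAt_three_of_model` (the four cases by `n mod 9`, for
  every model, `kodairaSymbolAt_smul'`).

Numerical cross-check (EVIDENCE, not used): PARI `elllocalred` on `y² = x³ − 432n²`, all cube-free
`n ≤ 400` (kit j293806): at `3` exactly III* (`c = 2`) for `n ≡ ±2 (9)`, IV* (`c ∈ {1,3}`) for
`n ≡ ±1, ±4 (9)`, II* (`c = 1`) for `3 ∥ n`, II (`c = 1`) for `9 ∥ n`. The template is x1b's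
`Theorems/SylvesterTwoHeegnerIndexLocalTypes.lean` (primes `p ≡ 4, 7 (mod 9)` only; it imports a route
file and is therefore not imported here).

References: O. G. Rizzo, Compositio Math. 136 (2003) Table II [Rizzo2003]; I. Papadopoulos, J. Number
Theory 44 (1993) Table III [Papadopoulos1993]; J. H. Silverman, *ATAEC* IV.9.4 and Table 4.1
[SilvermanATAEC1994]; Hu–Shu–Yin 2019 p. 4 (the model) [HuShuYin2019].
-/

set_option autoImplicit false

noncomputable section

open scoped Classical NumberField

open WeierstrassCurve NumberField IsDedekindDomain IsDedekindDomain.HeightOneSpectrum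
  Rat.HeightOneSpectrum Literature.NumberTheory.EllipticCurves
  Literature.NumberTheory.EllipticCurves.HuShuYin2019
  Literature.NumberTheory.EllipticCurves.Rizzo
  Literature.NumberTheory.DiophantineGeometry
  Literature.NumberTheory.GaloisRepresentations
  Summit.BirchSwinnertonDyer.Rank1Residual.X12.CMRamifiedRecords

namespace Summit.BirchSwinnertonDyer.Rank1Residual.P2.CubeSum

/-! ## §0 The model `y² = x³ − 432n²` as a Mordell equation with integer coefficient -/

/-- `cubeSumCurve n = (y² = x³ + k)` with the INTEGER `k = −432n²`. [cite: HuShuYin2019, p. 4] -/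
theorem cubeSumCurve_eq_mordell (n : ℤ) :
    cubeSumCurve (n : ℚ) = ⟨0, 0, 0, 0, ((-432 * n ^ 2 : ℤ) : ℚ)⟩ := by
  simp only [cubeSumCurve]; push_cast; rfl

/-- `−432n² ≠ 0` for `n ≠ 0`. [folklore] -/
theorem mordellCoeff_ne_zero {n : ℤ} (hn : n ≠ 0) : (-432 * n ^ 2 : ℤ) ≠ 0 :=
  mul_ne_zero (by norm_num) (pow_ne_zero _ hn)

/-- `|−432n²| = 432·|n|²`. [folklore] -/
theorem natAbs_mordellCoeff (n : ℤ) : (-432 * n ^ 2 : ℤ).natAbs = 432 * n.natAbs ^ 2 := by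
  rw [Int.natAbs_mul, Int.natAbs_neg, Int.natAbs_pow]; rfl

/-- `v_p(432n²) = 2·v_p(n)` at a prime `p ≥ 5`. [folklore] -/
theorem factorization_mordellCoeff {n : ℤ} (hn : n ≠ 0) {p : ℕ} (hp : p.Prime) (hp5 : 5 ≤ p) :
    (-432 * n ^ 2 : ℤ).natAbs.factorization p = 2 * n.natAbs.factorization p := by
  have hn' : n.natAbs ≠ 0 := Int.natAbs_ne_zero.mpr hn
  rw [natAbs_mordellCoeff, Nat.factorization_mul (by norm_num) (pow_ne_zero _ hn'),
    Nat.factorization_pow]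
  simp only [Finsupp.coe_add, Finsupp.coe_smul, Pi.add_apply, Pi.smul_apply, smul_eq_mul]
  have h432 : (432 : ℕ).factorization p = 0 := by
    refine Nat.factorization_eq_zero_of_not_dvd fun h => ?_
    have h' : p ∣ 2 ^ 4 * 3 ^ 3 := by norm_num; exact h
    rcases (Nat.Prime.dvd_mul hp).mp h' with h2 | h3
    · have := (Nat.prime_dvd_prime_iff_eq hp Nat.prime_two).mp (hp.dvd_of_dvd_pow h2); omega
    · have := (Nat.prime_dvd_prime_iff_eq hp Nat.prime_three).mp (hp.dvd_of_dvd_pow h3); omega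
  rw [h432, zero_add]

/-- Cube-free `n`: `v_p(n) ≤ 2` at every prime. [folklore] -/
theorem factorization_le_two_of_cubefree {n : ℤ} (hcf : ∀ p : ℕ, p.Prime → ¬ (p : ℤ) ^ 3 ∣ n)
    {p : ℕ} (hp : p.Prime) : n.natAbs.factorization p ≤ 2 := by
  by_contra h
  have h3 : p ^ 3 ∣ n.natAbs :=
    (hp.pow_dvd_iff_le_factorization (by
      intro h0; rw [h0, Nat.factorization_zero] at h; simp at h)).mpr (by omega)
  refine hcf p hp ?_
  have h4 : ((p ^ 3 : ℕ) : ℤ) ∣ n := Int.natCast_dvd.mpr h3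
  exact_mod_cast h4

/-! ## §2 The place over `3`: Rizzo's Table II on `c₄ = 0`, `c₆ = 2⁹3⁶n²`, `Δ = −2¹²3⁹n⁴` -/

section Three

/-- `c₆(E_n) = 373248·n² = 2⁹·3⁶·n²`. [cite: SilvermanAEC2009, III.1] -/
theorem cubeSumCurve_c₆ (n : ℚ) : (cubeSumCurve n).c₆ = 373248 * n ^ 2 := by
  simp only [cubeSumCurve, WeierstrassCurve.c₆, WeierstrassCurve.b₂, WeierstrassCurve.b₄,
    WeierstrassCurve.b₆]
  ring

/-- `Δ(E_n) = −80621568·n⁴ = −2¹²·3⁹·n⁴`. [cite: SilvermanAEC2009, III.1] -/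
theorem cubeSumCurve_Δ (n : ℚ) : (cubeSumCurve n).Δ = -(80621568 * n ^ 4) := by
  simp only [cubeSumCurve, WeierstrassCurve.Δ, WeierstrassCurve.b₂, WeierstrassCurve.b₄,
    WeierstrassCurve.b₆, WeierstrassCurve.b₈]
  ring

/-- `padicValRat 3 z = 0` for an integer `z` prime to `3`. [folklore] -/
theorem padicValRat_three_intCast_eq_zero {z : ℤ} (hz : ¬ (3 : ℤ) ∣ z) :
    padicValRat 3 (z : ℚ) = 0 := by
  rw [padicValRat.of_int, Nat.cast_eq_zero]
  exact padicValInt.eq_zero_of_not_dvd hz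

/-- `padicValRat 3 (3ᵏ·z) = k` for an integer `z ≠ 0` prime to `3`. [folklore] -/
theorem padicValRat_three_pow_mul_intCast {z : ℤ} (hz0 : z ≠ 0) (hz : ¬ (3 : ℤ) ∣ z) (k : ℕ) :
    padicValRat 3 ((3 : ℚ) ^ k * (z : ℚ)) = k := by
  haveI : Fact (Nat.Prime 3) := ⟨Nat.prime_three⟩
  rw [padicValRat.mul (pow_ne_zero _ (by norm_num)) (Int.cast_ne_zero.mpr hz0), padicValRat.pow,
    padicValRat_three_intCast_eq_zero hz,
    show (3 : ℚ) = ((3 : ℕ) : ℚ) by norm_num, padicValRat.self (by norm_num)]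
  simp

variable {e : ℕ} {m : ℤ}

/-- `c₆(E_{3ᵉm}) = 3^{6+2e} · (512m²)`. [folklore] -/
theorem c₆_eq_pow_mul (e : ℕ) (m : ℤ) :
    (cubeSumCurve (((3 : ℤ) ^ e * m : ℤ) : ℚ)).c₆ = (3 : ℚ) ^ (6 + 2 * e) * ((512 * m ^ 2 : ℤ) : ℚ) := by
  rw [cubeSumCurve_c₆]; push_cast; ring

/-- `Δ(E_{3ᵉm}) = −3^{9+4e} · (4096m⁴)`. [folklore] -/
theorem Δ_eq_pow_mul (e : ℕ) (m : ℤ) :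
    (cubeSumCurve (((3 : ℤ) ^ e * m : ℤ) : ℚ)).Δ = -((3 : ℚ) ^ (9 + 4 * e) * ((4096 * m ^ 4 : ℤ) : ℚ)) := by
  rw [cubeSumCurve_Δ]; push_cast; ring

/-- `3 ∤ 512m²` for `3 ∤ m`. [folklore] -/
theorem not_three_dvd_c₆' (hm : ¬ (3 : ℤ) ∣ m) : ¬ (3 : ℤ) ∣ 512 * m ^ 2 := by
  intro h
  rcases (Int.prime_three.dvd_mul).mp h with h | h
  · norm_num at h
  · exact hm (Int.prime_three.dvd_of_dvd_pow h)

/-- `3 ∤ 4096m⁴` for `3 ∤ m`. [folklore] -/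
theorem not_three_dvd_Δ' (hm : ¬ (3 : ℤ) ∣ m) : ¬ (3 : ℤ) ∣ 4096 * m ^ 4 := by
  intro h
  rcases (Int.prime_three.dvd_mul).mp h with h | h
  · norm_num at h
  · exact hm (Int.prime_three.dvd_of_dvd_pow h)

/-- `v₃(c₆(E_{3ᵉm})) = 6 + 2e` (`3 ∤ m`, `m ≠ 0`). [cite: Rizzo2003, §1.1 (p. 3)] -/
theorem padicValRat_three_c₆ (hm0 : m ≠ 0) (hm : ¬ (3 : ℤ) ∣ m) :
    padicValRat 3 (cubeSumCurve (((3 : ℤ) ^ e * m : ℤ) : ℚ)).c₆ = (6 + 2 * e : ℕ) := by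
  rw [c₆_eq_pow_mul]
  exact padicValRat_three_pow_mul_intCast (mul_ne_zero (by norm_num) (pow_ne_zero _ hm0))
    (not_three_dvd_c₆' hm) _

/-- `v₃(Δ(E_{3ᵉm})) = 9 + 4e` (`3 ∤ m`, `m ≠ 0`). [cite: Rizzo2003, §1.1 (p. 3)] -/
theorem padicValRat_three_Δ (hm0 : m ≠ 0) (hm : ¬ (3 : ℤ) ∣ m) :
    padicValRat 3 (cubeSumCurve (((3 : ℤ) ^ e * m : ℤ) : ℚ)).Δ = (9 + 4 * e : ℕ) := by
  rw [Δ_eq_pow_mul, padicValRat.neg]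
  exact padicValRat_three_pow_mul_intCast (mul_ne_zero (by norm_num) (pow_ne_zero _ hm0))
    (not_three_dvd_Δ' hm) _

/-- `v₃(c₄) = ∞` (`c₄ = 0`). [cite: Rizzo2003, §1.1 (p. 3)] -/
theorem val3_c₄ (n : ℚ) : val3 (cubeSumCurve n).c₄ = ⊤ := by
  rw [cubeSumCurve_c₄, val3, if_pos rfl]

/-- `v₃(c₆) = 6 + 2e` in the table's `WithTop ℤ`. [cite: Rizzo2003, §1.1 (p. 3)] -/
theorem val3_c₆ (hm0 : m ≠ 0) (hm : ¬ (3 : ℤ) ∣ m) :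
    val3 (cubeSumCurve (((3 : ℤ) ^ e * m : ℤ) : ℚ)).c₆ = (((6 + 2 * e : ℕ) : ℤ) : WithTop ℤ) := by
  have hne : (cubeSumCurve (((3 : ℤ) ^ e * m : ℤ) : ℚ)).c₆ ≠ 0 := by
    rw [c₆_eq_pow_mul]
    exact mul_ne_zero (pow_ne_zero _ (by norm_num))
      (Int.cast_ne_zero.mpr (mul_ne_zero (by norm_num) (pow_ne_zero _ hm0)))
  rw [val3, if_neg hne, padicValRat_three_c₆ hm0 hm]

/-- The prime-to-`3` part of `c₆` is the INTEGER `512m²`. [cite: Rizzo2003, p. 2 (notation x')] -/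
theorem primeToThreePart_c₆ (hm0 : m ≠ 0) (hm : ¬ (3 : ℤ) ∣ m) :
    primeToThreePart (cubeSumCurve (((3 : ℤ) ^ e * m : ℤ) : ℚ)).c₆ = ((512 * m ^ 2 : ℤ) : ℚ) := by
  rw [primeToThreePart, padicValRat_three_c₆ hm0 hm, c₆_eq_pow_mul, zpow_natCast,
    mul_div_cancel_left₀ _ (pow_ne_zero _ (by norm_num))]

/-- `c₆' ≡ 512m² (mod 9)` as the table reads it (`res9`). [cite: Rizzo2003, p. 2 and Table II] -/
theorem res9_c₆ (hm0 : m ≠ 0) (hm : ¬ (3 : ℤ) ∣ m) :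
    res9 (cubeSumCurve (((3 : ℤ) ^ e * m : ℤ) : ℚ)).c₆ = (512 * m ^ 2) % 9 := by
  rw [res9, primeToThreePart_c₆ hm0 hm]
  simp only [Rat.den_intCast, Rat.num_intCast, if_true]

/-- `512m² mod 9 ∈ {8, 5, 2}` as `m² ≡ 1, 4, 7 (mod 9)`, i.e. as `m ≡ ±1, ±2, ±4 (mod 9)`. [folklore] -/
theorem c₆'_emod_nine (m : ℤ) :
    ((m % 9 = 1 ∨ m % 9 = 8) → (512 * m ^ 2) % 9 = 8) ∧
    ((m % 9 = 2 ∨ m % 9 = 7) → (512 * m ^ 2) % 9 = 5) ∧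
    ((m % 9 = 4 ∨ m % 9 = 5) → (512 * m ^ 2) % 9 = 2) := by
  refine ⟨fun h => ?_, fun h => ?_, fun h => ?_⟩ <;> rcases h with h | h <;>
    · rw [pow_two, Int.mul_emod, Int.mul_emod m m, h]; norm_num

/-- `res9 c₄ = res9 0`, so `c_{4,4} = 0` on the rows `(≥4, 6, 9)`. [cite: Rizzo2003, p. 2 (notation c_{n,e})] -/
theorem c4e_top_eq_zero (x : ℤ) : c4e ⊤ x 4 = 0 := rfl

/-- **Table II on `E_m`, `m ≡ ±2 (mod 9)`: reduced triple `(∞, 6, 9)`, `c₆' ≡ 5`, special condition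
`5² + 2 ≡ 0 = 3c_{4,4} (mod 9)` HOLDS: Kodaira `III*`.** [cite: Rizzo2003, Table II (p. 4), row (≥4,6,9)]
[cite: Papadopoulos1993, Table III (p = 3)] -/
theorem tableKodairaSymbolThree_of_emod_nine_two_seven (hm0 : m ≠ 0) (h9 : m % 9 = 2 ∨ m % 9 = 7) :
    (cubeSumCurve (((3 : ℤ) ^ 0 * m : ℤ) : ℚ)).tableKodairaSymbolThree = .IIIstar := by
  have hm : ¬ (3 : ℤ) ∣ m := by omega
  rw [tableKodairaSymbolThree, kodairaOfInvariants_eq_of_shift_zero (a := ⊤)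
    (b := ((6 : ℤ) : WithTop ℤ)) (c := 9) (k := 0) (by rw [val3_c₄]; rfl)
    (by rw [val3_c₆ hm0 hm]; simp) (by rw [padicValRat_three_Δ hm0 hm]; norm_num) (by decide),
    res9_c₆ hm0 hm, (c₆'_emod_nine m).2.1 h9]
  exact kodaira_row_ge4_6_9_of_sp (a := ⊤) rfl _ _ _ (by rw [c4e_top_eq_zero]; decide)

/-- **Table II on `E_m`, `m ≡ ±1, ±4 (mod 9)`: reduced triple `(∞, 6, 9)`, `c₆' ≡ 8` resp. `2`, special
condition FAILS (`66, 6 ≢ 0`), corrected clause `c₆' ≢ 4, 5` holds: Kodaira `IV*`.**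
[cite: Rizzo2003, Table II (p. 4), row (≥5,6,9)] [cite: Varillyalvarado2011, Rem. 4.2]
[cite: Papadopoulos1993, Table III (p = 3)] -/
theorem tableKodairaSymbolThree_of_emod_nine_one_four (hm0 : m ≠ 0)
    (h9 : m % 9 = 1 ∨ m % 9 = 8 ∨ m % 9 = 4 ∨ m % 9 = 5) :
    (cubeSumCurve (((3 : ℤ) ^ 0 * m : ℤ) : ℚ)).tableKodairaSymbolThree = .IVstar := by
  have hm : ¬ (3 : ℤ) ∣ m := by omega
  rw [tableKodairaSymbolThree, kodairaOfInvariants_eq_of_shift_zero (a := ⊤)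
    (b := ((6 : ℤ) : WithTop ℤ)) (c := 9) (k := 0) (by rw [val3_c₄]; rfl)
    (by rw [val3_c₆ hm0 hm]; simp) (by rw [padicValRat_three_Δ hm0 hm]; norm_num) (by decide),
    res9_c₆ hm0 hm]
  rcases h9 with h | h | h | h
  · rw [(c₆'_emod_nine m).1 (Or.inl h)]
    exact kodaira_row_ge5_6_9_of_not_sp (a := ⊤) rfl WithTop.top_ne_coe _ _ _
      (by rw [c4e_top_eq_zero]; decide) (by decide)
  · rw [(c₆'_emod_nine m).1 (Or.inr h)]
    exact kodaira_row_ge5_6_9_of_not_sp (a := ⊤) rfl WithTop.top_ne_coe _ _ _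
      (by rw [c4e_top_eq_zero]; decide) (by decide)
  · rw [(c₆'_emod_nine m).2.2 (Or.inl h)]
    exact kodaira_row_ge5_6_9_of_not_sp (a := ⊤) rfl WithTop.top_ne_coe _ _ _
      (by rw [c4e_top_eq_zero]; decide) (by decide)
  · rw [(c₆'_emod_nine m).2.2 (Or.inr h)]
    exact kodaira_row_ge5_6_9_of_not_sp (a := ⊤) rfl WithTop.top_ne_coe _ _ _
      (by rw [c4e_top_eq_zero]; decide) (by decide)

/-- **Table II on `E_{3m}`, `3 ∤ m`: valuations `(∞, 8, 13)`, one rescaling above the reduced triple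
`(∞, 2, 1)` (row ★): Kodaira `II*`.** [cite: Rizzo2003, Table II (p. 4), row (≥2,2,1)]
[cite: Papadopoulos1993, Table III (p = 3)] -/
theorem tableKodairaSymbolThree_three_mul (hm0 : m ≠ 0) (hm : ¬ (3 : ℤ) ∣ m) :
    (cubeSumCurve (((3 : ℤ) ^ 1 * m : ℤ) : ℚ)).tableKodairaSymbolThree = .IIstar := by
  rw [tableKodairaSymbolThree, kodairaOfInvariants_eq_of_shift_one (a := ⊤)
    (b := ((8 : ℤ) : WithTop ℤ)) (c := 13) (k := 0) (by rw [val3_c₄]; rfl)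
    (by rw [val3_c₆ hm0 hm]; simp) (by rw [padicValRat_three_Δ hm0 hm]; norm_num) (by decide)]
  exact kodaira_row_ge2_2_1 (a := ⊤) rfl (by decide) (by decide) _ _ _

/-- **Table II on `E_{9m}`, `3 ∤ m`: valuations `(∞, 10, 17)`, one rescaling above the reduced triple
`(∞, 4, 5)`: Kodaira `II`.** [cite: Rizzo2003, Table II (p. 4), row (≥3,4,5)]
[cite: Papadopoulos1993, Table III (p = 3)] -/
theorem tableKodairaSymbolThree_nine_mul (hm0 : m ≠ 0) (hm : ¬ (3 : ℤ) ∣ m) :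
    (cubeSumCurve (((3 : ℤ) ^ 2 * m : ℤ) : ℚ)).tableKodairaSymbolThree = .II := by
  rw [tableKodairaSymbolThree, kodairaOfInvariants_eq_of_shift_one (a := ⊤)
    (b := ((10 : ℤ) : WithTop ℤ)) (c := 17) (k := 0) (by rw [val3_c₄]; rfl)
    (by rw [val3_c₆ hm0 hm]; simp) (by rw [padicValRat_three_Δ hm0 hm]; norm_num) (by decide)]
  exact kodaira_row_ge3_4_5 (a := ⊤) rfl (by decide) _ _ _

/-- **The Kodaira symbol at `3` of every model of `E_n` is Table II's Kod entry for `y² = x³ − 432n²`**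
(Tate's algorithm = Table II, `kodairaSymbolAt_eq_tableKodairaSymbolThree_of_primesEquiv_eq`;
model-independence `kodairaSymbolAt_smul'`). [cite: Rizzo2003, Table II (p. 4)]
[cite: Silverman1994, IV.9.4 and Table 4.1] -/
theorem kodairaSymbolAt_three_of_model_eq_table {n : ℤ} (hn : n ≠ 0) (B : WeierstrassCurve ℚ)
    [B.IsElliptic] (hB : ∃ C : VariableChange ℚ, C • B = cubeSumCurve (n : ℚ))
    (v : HeightOneSpectrum (𝓞 ℚ)) (hv : natGenerator v = 3) :
    B.kodairaSymbolAt v = (cubeSumCurve (n : ℚ)).tableKodairaSymbolThree := by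
  obtain ⟨C, hC⟩ := hB
  haveI := X12.CubeSumFamilies.isElliptic_cubeSumCurve (n := (n : ℚ)) (by exact_mod_cast hn)
  haveI : PerfectField (IsLocalRing.ResidueField (v.adicCompletionIntegers ℚ)) :=
    PerfectField.ofFinite
  rw [← kodairaSymbolAt_smul' v B C, hC]
  exact kodairaSymbolAt_eq_tableKodairaSymbolThree_of_primesEquiv_eq v _ hv

/-- **KODAIRA TYPE AT `3` OF THE CUBE-SUM CURVE `x³ + y³ = n`, `n` cube-free** (every model `B`, the
place `v ∣ 3`): `III*` if `n ≡ ±2 (mod 9)`; `II*` if `3 ∥ n`; `II` if `9 ∥ n`; `IV*` otherwise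
(`n ≡ ±1, ±4 (mod 9)`). [cite: Rizzo2003, Table II (p. 4)] [cite: Papadopoulos1993, Table III (p = 3)]
[cite: Silverman1994, IV.9.4 and Table 4.1] -/
theorem kodairaSymbolAt_three_of_model {n : ℤ} (hn : n ≠ 0)
    (hcf : ∀ p : ℕ, p.Prime → ¬ (p : ℤ) ^ 3 ∣ n) (B : WeierstrassCurve ℚ) [B.IsElliptic]
    (hB : ∃ C : VariableChange ℚ, C • B = cubeSumCurve (n : ℚ))
    (v : HeightOneSpectrum (𝓞 ℚ)) (hv : natGenerator v = 3) :
    B.kodairaSymbolAt v =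
      if n % 9 = 2 ∨ n % 9 = 7 then .IIIstar
      else if n % 9 = 3 ∨ n % 9 = 6 then .IIstar
      else if n % 9 = 0 then .II else .IVstar := by
  rw [kodairaSymbolAt_three_of_model_eq_table hn B hB v hv]
  have h27 : ¬ (27 : ℤ) ∣ n := fun h => hcf 3 Nat.prime_three (by norm_num; exact h)
  by_cases h2 : n % 9 = 2 ∨ n % 9 = 7
  · rw [if_pos h2, show (n : ℚ) = (((3 : ℤ) ^ 0 * n : ℤ) : ℚ) by simp]
    exact tableKodairaSymbolThree_of_emod_nine_two_seven hn h2
  rw [if_neg h2]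
  by_cases h3 : n % 9 = 3 ∨ n % 9 = 6
  · rw [if_pos h3]
    obtain ⟨m, rfl⟩ : ∃ m, n = 3 * m := ⟨n / 3, by omega⟩
    have hm0 : m ≠ 0 := by rintro rfl; exact hn rfl
    have hm : ¬ (3 : ℤ) ∣ m := by omega
    rw [show ((3 * m : ℤ) : ℚ) = (((3 : ℤ) ^ 1 * m : ℤ) : ℚ) by rw [pow_one]]
    exact tableKodairaSymbolThree_three_mul hm0 hm
  rw [if_neg h3]
  by_cases h0 : n % 9 = 0
  · rw [if_pos h0]
    obtain ⟨m, rfl⟩ : ∃ m, n = 9 * m := ⟨n / 9, by omega⟩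
    have hm0 : m ≠ 0 := by rintro rfl; exact hn rfl
    have hm : ¬ (3 : ℤ) ∣ m := by omega
    rw [show ((9 * m : ℤ) : ℚ) = (((3 : ℤ) ^ 2 * m : ℤ) : ℚ) by norm_num]
    exact tableKodairaSymbolThree_nine_mul hm0 hm
  · rw [if_neg h0, show (n : ℚ) = (((3 : ℤ) ^ 0 * n : ℤ) : ℚ) by simp]
    exact tableKodairaSymbolThree_of_emod_nine_one_four hn (by omega)

end Three

end Summit.BirchSwinnertonDyer.Rank1Residual.P2.CubeSum

end
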